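import Summits.BirchSwinnertonDyer.BirchSwinnertonDyer.Theorems.ClassRecordThreeCornerAtThreeUpperShimuraInert
import HarnessLib

/-!
# Crux `CornerAtThreeW` (item stmt-BirchSwinnertonDyer-21420; routes `ClassRecordThree` ∕ `KolyvaginRoadThree`; 19111
# `CornerAtThree` aside), conjunct (U) along the carrier-inert Shimura road: the TWIN-LOWER SUPPLY at a
# Friedberg–Hoffstein frame — definitions home (cell `bsd-stepL`, seat `bsd-stepL-corner3-p2` g6 = WIDTH-LEVER lane B
# «Kolyvagin-system bound at p = 3 instead of the IMC road»; `--supports stmt-BirchSwinnertonDyer-21420 --as helper`)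

Theses-free (imports NO `Theses/` and NO `Cruxes/` module). Contents: ONE `Prop`-valued predicate `FHTwinLowerSupplyAt W p`
(an UNTAGGED parametrised predicate; implied by BSD of the rank-`0` twists together with Friedberg–Hoffstein's
non-vanishing theorem; nothing asserted), its class-wide form on the (T4″)₃ corner `CornerAtThreeFHTwinLowerSupply` (a `Prop`
constant carrying the open-conjecture attribute), and TWO bookkeeping theorems: the predicate is IMPLIED by the pair of inputs it replaces (Friedberg–Hoffstein's
inert supply `friedbergHoffstein_exists_twist_ne_zero_inertAt` ∧ the X11a lower half at `p`) on X11b ∧ ¬(ram) pairs, and the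
class-wide form by the same pair read at `3` on the corner (conjunct 4 of the registered `stub_upper3_inertDisplay` of
`Cruxes/CornerAtThreeW/Lines/inert.lean` VERBATIM). NO named fact, no instance, no notation, no `sorry`.

## Why

The carrier-inert Shimura road to the consumer shape (U′) = `Theorems.CornerAtThreeUpperConsumed` (this seat g3–g5; cores
`missingUpperBoundAt_of_classX11b_of_not_ram_of_{inert,split}Set_odd`, glue `Three.corner_missingUpperBoundAt_of_admissibleSet`,
`cornerAtThreeUpperConsumed_of_display_of_residual`) reads the rank-`0` TWIN `E^{d_K}` at the Friedberg–Hoffstein frame `K`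
through ONE inequality: its `≥`-half `ord_p L(E^d,1)/Ω(E^d) ≤ ord_p #Ш(E^d) + ord_p ∏c(E^d) − 2·ord_p #tors(E^d)`, taken today
from the IMC-grade shared object `X11aLowerHalf` at `p` (`∀ V, ClassX11a V p → Typed.MissingLowerBoundAt V p`; at `p = 3` = item
19064 at `3`; NO print at image `N(C)`: Skinner 2016 Thm. C needs a (ram) prime, Skinner–Urban surjectivity). Since the frame is
CHOSEN among infinitely many (Friedberg–Hoffstein 1995 Thm. B), it may be chosen so that the twin is EXACT at `p`
(`ord_p L(E^d,1)/Ω(E^d) ≤ ord_p ∏c(E^d) − 2 ord_p #tors(E^d)`, i.e. `p ∤ #Ш(E^d)_an`), where the `≥`-half is the trivial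
`0 ≤ ord_p #Ш(E^d)` — Kolyvagin's own way with the auxiliary imaginary quadratic field. `FHTwinLowerSupplyAt W p` packages
exactly what the cores consume: for every even set of multiplicative primes, SOME imaginary quadratic `K` with `|d_K| > 4`, the
set inert and prime to `d_K`, every other bad prime split, `L(E^{d_K},1) ≠ 0`, WITH a global minimal model `Wd` of the twist and
a rational `q = L(Wd,1)/Ω(Wd)` carrying the `≥`-half. The re-keyed cores `…UpperShimuraInertOfTwinLower` ∕ `…SplitOfTwinLower`
(this seat g6) take its raw body as their binder `hTL`; with it the road to (U′) has NO main-conjecture input at all on the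
admissible corner curves (census 159 ∕ 208 with `3 ∣ ∏c`; EVIDENCE, T7): {`casselsTate_levelInputs`, the CM-point primitives of
`X_{N⁺,N⁻}` at `3`, this supply, named print}.

STATUS IN PRINT of the supply: per pair it is a FINITE CERTIFICATE (one fundamental `d`, one exact rational `L(E^d,1)/Ω(E^d)` by
modular symbols; this seat's census kit, EVIDENCE only); class-wide it is a non-vanishing-MOD-`p` statement for quadratic twists
with prescribed local behaviour (Friedberg–Hoffstein × Ono–Skinner 1998 shape) — BEYOND PRINT at `p = 3 ∣ N` (Ono–Skinner's
Fundamental Theorem excludes a finite set of primes containing the divisors of `6·N·∏c`; Bruinier 1999 needs `p ∤` level).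
It is NOT an Iwasawa main conjecture and carries no Galois-image hypothesis. HONEST FRAMING: typed SHAPES and bookkeeping;
CONDITIONAL wherever used; nothing booked; no census word, tier or label moves (T7); item 21420 is NOT closed; BSD(E,3) is
proved for no class by this file.

References: [FriedbergHoffstein1995] Thm. B; [OnoSkinner1998] Fundamental Thm. and Cor. 3 (Ann. Math. 147, pp. 453–470);
[Kolyvagin1990Euler] §2 (the auxiliary field); [JetchevSkinnerWan2017] §7.4.2 (pp. 30–31: where the twin's half is consumed);
[Skinner2016PacificMC] Thm. C (display shape of the `≥`-half); [Miller2011LMS] Def. 1.1; HOME/corner3/g6/CORNER3-G6.md.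
-/

noncomputable section

open scoped Classical

open WeierstrassCurve NumberField IsDedekindDomain Literature.NumberTheory.EllipticCurves
  Rat.HeightOneSpectrum CongruenceSubgroup
  Literature.NumberTheory.EllipticCurves.ModularForms
  Literature.NumberTheory.EllipticCurves.Rank1Residual
  Literature.NumberTheory.EllipticCurves.Rank1Residual.Typed
  Literature.NumberTheory.QuadraticFields.Quadratic
  Literature.NumberTheory.EllipticCurves.BarriosEtAl2025
  Literature.NumberTheory.Automorphic
  Summit.BirchSwinnertonDyer.Rank1Residual
  Summit.BirchSwinnertonDyer.Rank1Residual.X11b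

-- the cell's Theorems namespace repeats the summit name (Summit.<Summit>.<Problem>), as in every sibling file
set_option linter.dupNamespace false

namespace Summit.BirchSwinnertonDyer.BirchSwinnertonDyer.Theorems

/-! ### §1. The typed input -/

/-- OPEN (typed open input; implied by the `≥`-half of BSD of the rank-`0` twists at Friedberg–Hoffstein fields) —
**`FHTwinLowerSupplyAt W p`: the TWIN-LOWER SUPPLY at a carrier-inert Friedberg–Hoffstein frame.** For `E = W/ℚ` and EVERY
even set `T` of multiplicative primes of `E`: there is SOME imaginary quadratic field `K` with `|d_K| > 4` (so `w_K = 2`), every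
`ℓ ∈ T` inert in `K` and prime to `d_K`, every other bad prime of `E` split in `K`, `L(E^{(d_K)},1) ≠ 0` — the FRAME, exactly
the ∃-body of `friedbergHoffstein_exists_twist_ne_zero_inertAt` with `B = 4` — TOGETHER WITH a global minimal model
`Wd = Cd • E^{(d_K)}` of the twist and a rational `q = L(Wd,1)/Ω(Wd)` carrying the twin's `≥`-half
`ord_p q ≤ ord_p #Ш(Wd) + ord_p ∏c(Wd) − 2·ord_p #tors(Wd)` (the display a main-conjecture argument would give — Skinner 2016
Thm. C's shape; FREE at an exact twin, `CornerTwinHalves.twinLower_of_exact`). Exactly the binder `hTL` of the re-keyed cores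
`missingUpperBoundAt_of_classX11b_of_{inert,split}Set_odd_of_twinLower`. WEAKER than (Friedberg–Hoffstein inert supply ∧ the
X11a lower half at `p`) on X11b ∧ ¬(ram) pairs (`fhTwinLowerSupplyAt_of_friedbergHoffstein_of_x11aLowerHalf`). A predicate on
`(W, p)`; NEVER a theorem in this cell; every result using it is CONDITIONAL. UNTAGGED (plan g42 RULING 75 ∕ plan g43 RULINGS 80 (c)
and 84 (b): only CLOSED `Prop`s carry the open-conjecture attribute — the class-wide `CornerAtThreeFHTwinLowerSupply` below keeps it; a
PARAMETRISED predicate carrying that attribute and reached by a route item's body trips the gate's undeclared-tag readiness check, and so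
does a docstring of an untagged declaration that spells the attribute out — hence the wording here).
[cite: FriedbergHoffstein1995, Thm. B (the frame exists; shape only — nothing asserted)]
[cite: OnoSkinner1998, Cor. 3 (shape of a unit-twin supply; its hypotheses exclude p ∣ 6N∏c — nothing asserted)]
[cite: Skinner2016PacificMC, Thm. C (display shape of the `≥`-half; VOID on the rank-0 corner — nothing asserted)] -/
def FHTwinLowerSupplyAt (W : WeierstrassCurve ℚ) [W.IsElliptic] (p : ℕ) : Prop :=
  ∀ (T : Finset ℕ), (∀ ℓ ∈ T, ∃ _ : Fact ℓ.Prime, Mult W ℓ) → Even T.card →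
    ∃ (K : Type) (_ : Field K) (_ : NumberField K)
      (Wd : WeierstrassCurve ℚ) (_ : Wd.IsElliptic) (_ : Wd.IsGloballyMinimal) (Cd : VariableChange ℚ),
      IsImaginaryQuadratic K ∧ 4 < (NumberField.discr K).natAbs ∧
      (∀ ℓ ∈ T, ((Ideal.span {(ℓ : ℤ)}).primesOver (𝓞 K)).ncard = 1 ∧ ¬ (ℓ : ℤ) ∣ NumberField.discr K) ∧
      (∀ ℓ : ℕ, ℓ.Prime → ℓ ∣ W.conductorNorm ℤ → ℓ ∉ T →
        ((Ideal.span {(ℓ : ℤ)}).primesOver (𝓞 K)).ncard = 2) ∧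
      (W.quadraticTwist (NumberField.discr K : ℚ)).entireLFunction 1 ≠ 0 ∧
      Cd • W.quadraticTwist (NumberField.discr K : ℚ) = Wd ∧
      ∃ q : ℚ, Wd.entireLFunction 1 / (Wd.realPeriodRat : ℂ) = (q : ℂ) ∧
        padicValRat p q ≤ (padicValNat p Wd.shaOrder : ℤ) + padicValNat p Wd.tamagawaProduct -
          2 * padicValNat p Wd.torsionOrder

/-- OPEN — **`CornerAtThreeFHTwinLowerSupply`**: the class-wide form of the supply on the (T4″)₃ corner
(`∀ W, ClassX11b W 3 → ¬ Surj W 3 → FHTwinLowerSupplyAt W 3`) — the proposed replacement for conjunct 4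
(`∀ V, ClassX11a V 3 → Typed.MissingLowerBoundAt V 3` = item 19064 read at `3`, IMC-grade) of the registered
`stub_upper3_inertDisplay` of `Cruxes/CornerAtThreeW/Lines/inert.lean` (planner action). WEAKER than that conjunct given
Friedberg–Hoffstein (`cornerAtThreeFHTwinLowerSupply_of_friedbergHoffstein_of_x11aLowerHalfAtThree`). A `Prop` constant; OPEN;
nothing asserted. [cite: FriedbergHoffstein1995, Thm. B (shape only)] [cite: OnoSkinner1998, Cor. 3 (shape only)] -/
@[conjecture]
def CornerAtThreeFHTwinLowerSupply : Prop :=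
  ∀ (W : WeierstrassCurve ℚ) [W.IsElliptic] [W.IsGloballyMinimal], ClassX11b W 3 → ¬ Surj W 3 → FHTwinLowerSupplyAt W 3

/-! ### §2. The supply is WEAKER than the pair of inputs it replaces -/

/-- **`FHTwinLowerSupplyAt W p` ⟸ Friedberg–Hoffstein's inert supply ∧ the X11a lower half at `p`, on an X11b pair with
no (ram) prime** (`p` odd, `ρ̄_{E,p}` irreducible, surjective or not). At the Friedberg–Hoffstein field (`|d_K| > 4`, the
set `T` inert, the other bad primes split, `L(E^{d_K},1) ≠ 0`) take a global minimal model of the twist (Néron,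
`hasGlobalMinimalModel_rat_holds`); it is a rank-`0` X11a pair at `p` — multiplicative at `p` (inert case:
`mult_twist_of_jacobiSym` inside `classX11a_twist_of_not_ram_inertSet`; split case: `d_K` is a square in `ℚ_p`),
`E^{d}[p]` irreducible, no (ram) prime (`not_ram_twist_of_inertSet`) — so `hX11a` applies, and
`exists_printShape_lower_of_missingLowerBoundAt_rankZero` puts its conclusion in the displayed shape. This is the X11a
placement that the cores of record performed inline (this seat g3, `…UpperShimuraInert` ∕ `…UpperShimuraSplit`), isolated.
Bookkeeping; CONDITIONAL on `hGZK`, `hmod`, `hnf`, `hFH`, `hX11a`.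
-- adapted from Summits/BirchSwinnertonDyer/BirchSwinnertonDyer/Theorems/ClassRecordThreeCornerAtThreeUpperShimuraSplit.lean (X11a placement)
[cite: FriedbergHoffstein1995, Thm. B] [cite: Skinner2016PacificMC, Thm. C (shape)] [cite: Miller2011LMS, Def. 1.1] -/
theorem fhTwinLowerSupplyAt_of_friedbergHoffstein_of_x11aLowerHalf
    (hGZK : rank_eq_analyticRank_of_analyticRank_le_one) (hmod : hasEntireLFunction_rat)
    (hnf : exists_isNewformOf)
    (hFH : friedbergHoffstein_exists_twist_ne_zero_inertAt)
    (W : WeierstrassCurve ℚ) [W.IsElliptic] [W.IsGloballyMinimal] (p : ℕ) [Fact p.Prime]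
    (hX : ClassX11b W p) (hnram : ¬ Ram W p)
    (hX11a : ∀ (Wd : WeierstrassCurve ℚ) [Wd.IsElliptic] [Wd.IsGloballyMinimal],
      ClassX11a Wd p → Typed.MissingLowerBoundAt Wd p) :
    FHTwinLowerSupplyAt W p := by
  intro T hTmult hTeven
  have hp : p.Prime := Fact.out
  obtain ⟨hr, hp2, hmult, hirr⟩ := id hX
  -- the sign of the functional equation is `−1` (modularity, `r_an = 1`)
  have hw : W.rootNumber = -1 := by
    rw [WeierstrassCurve.rootNumber_eq_neg_one_pow_analyticRank_of_exists_isNewformOf hnf W, hr]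
    norm_num
  -- the Friedberg–Hoffstein field, `T` inert, every other bad prime split, `|d_K| > 4`
  obtain ⟨K, _, _, hK, hdisc, hinert, hsplitN, hLt⟩ := hFH W hw T hTmult hTeven 4
  have h2 := hK.1
  have hTin : ∀ ℓ ∈ T, ∃ _ : Fact ℓ.Prime, Mult W ℓ ∧
      ((ℓ ≠ 2 ∧ jacobiSym (NumberField.discr K) ℓ = -1) ∨ (ℓ = 2 ∧ NumberField.discr K % 8 = 5)) := by
    intro ℓ hℓ
    obtain ⟨hℓF, hm⟩ := hTmult ℓ hℓ
    obtain ⟨hn, hd⟩ := hinert ℓ hℓ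
    refine ⟨hℓF, hm, ?_⟩
    have hn' : ((Ideal.span {(ℓ : ℤ)}).primesOver (𝓞 K)).ncard ≠ 2 := by rw [hn]; decide
    by_cases hℓ2 : ℓ = 2
    · subst hℓ2
      have hn2 : ((Ideal.span {(2 : ℤ)}).primesOver (𝓞 K)).ncard ≠ 2 := by
        simpa only [Nat.cast_ofNat] using hn'
      have hd2 : ¬ (2 : ℤ) ∣ NumberField.discr K := by simpa only [Nat.cast_ofNat] using hd
      exact Or.inr ⟨rfl, discr_emod_eight_eq_five_of_ncard_ne_two h2 hn2 hd2⟩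
    · exact Or.inl ⟨hℓ2, jacobiSym_discr_eq_neg_one_of_ncard_ne_two h2 hℓF.out hℓ2 hn' hd⟩
  have hsplit : ∀ (ℓ : ℕ) [Fact ℓ.Prime], ¬ W.HasGoodReductionAtPrime ℓ → ℓ ∉ T →
      IsSquare (algebraMap ℚ ℚ_[ℓ] (NumberField.discr K : ℚ)) := by
    intro ℓ hℓF hg hℓT
    have hℓN : ℓ ∣ W.conductorNorm ℤ := (W.dvd_conductorNorm_iff_not_hasGoodReductionAtPrime ℓ).mpr hg
    exact isSquare_discr_padic_of_ncard_eq_two h2 ℓ (hsplitN ℓ hℓF.out hℓN hℓT)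
  -- a globally minimal model of the twist
  have hD0 : (NumberField.discr K : ℚ) ≠ 0 := by exact_mod_cast NumberField.discr_ne_zero K
  haveI hEt : (W.quadraticTwist (NumberField.discr K : ℚ)).IsElliptic :=
    W.isElliptic_quadraticTwist hD0
  obtain ⟨Cd, hCd⟩ := hasGlobalMinimalModel_rat_holds (W.quadraticTwist (NumberField.discr K : ℚ))
  haveI : (Cd • W.quadraticTwist (NumberField.discr K : ℚ)).IsGloballyMinimal := hCd
  set Wd : WeierstrassCurve ℚ := Cd • W.quadraticTwist (NumberField.discr K : ℚ) with hWd_def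
  have hWd : Cd • W.quadraticTwist (NumberField.discr K : ℚ) = Wd := rfl
  -- the twist has analytic rank `0` and `E^{d}[p]` irreducible
  have hirrd : Wd.HasIrreducibleModPGaloisRep p :=
    hasIrreducibleModPGaloisRep_twist_model W p K h2 hirr Cd hWd
  have hLt' : (W.quadraticTwist (NumberField.discr K : ℚ)).entireLFunction = Wd.entireLFunction := by
    rw [← hWd, entireLFunction_smul]
  have hLd1 : Wd.entireLFunction 1 ≠ 0 := by rw [← hLt']; exact hLt
  have hrd : Wd.analyticRank = 0 := (Wd.analyticRank_eq_zero_iff_holds (hmod Wd)).2 hLd1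
  -- the twist is an X11a pair at `p`: `p` inert (in `T`) or split (off `T`)
  have hXd : ClassX11a Wd p := by
    by_cases hpT : p ∈ T
    · obtain ⟨hnp, hdp⟩ := hinert p hpT
      have hJp : jacobiSym (NumberField.discr K) p = -1 :=
        jacobiSym_discr_eq_neg_one_of_ncard_ne_two h2 hp hp2 (by rw [hnp]; decide) hdp
      exact classX11a_twist_of_not_ram_inertSet W p hX hnram K h2 hJp T hTin
        (fun ℓ _ hg hℓT ↦ hsplit ℓ hg hℓT) Cd hWd hrd
    · have hmultd : Mult Wd p := by
        have hsq : IsSquare (algebraMap ℚ ℚ_[p] (NumberField.discr K : ℚ)) :=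
          hsplit p (WeierstrassCurve.HasMultiplicativeReduction.not_hasGoodReduction (R := ℤ_[p]) hmult) hpT
        have h' : (Cd • W.quadraticTwist (NumberField.discr K : ℚ)).HasMultiplicativeReductionAtPrime p := by
          rw [hasMultiplicativeReductionAtPrime_smul_iff]
          exact (hasMultiplicativeReductionAtPrime_quadraticTwist_iff W hD0 hsq).mpr hmult
        exact h'
      exact ⟨hrd, hp2, hmultd, hirrd,
        not_ram_twist_of_inertSet W p K T hTin (fun ℓ _ hg hℓT ↦ hsplit ℓ hg hℓT) hnram Cd hWd⟩
  -- the X11a lower half at the twist, in print shape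
  obtain ⟨qS, hqS, hvqS⟩ :=
    AdditivePotMult.exists_printShape_lower_of_missingLowerBoundAt_rankZero (p := p) Wd hGZK hrd hirrd
      (hX11a Wd hXd)
  exact ⟨K, inferInstance, inferInstance, Wd, inferInstance, hCd, Cd, hK, hdisc, hinert, hsplitN, hLt, hWd,
    qS, hqS, hvqS⟩

/-- **The class-wide corner form ⟸ Friedberg–Hoffstein ∧ conjunct 4 of the registered `stub_upper3_inertDisplay`**
(`∀ V, ClassX11a V 3 → Typed.MissingLowerBoundAt V 3`, item 19064 read at `3`, statement VERBATIM): on the corner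
`¬ Surj W 3 ∧ (irr)` forces «no (ram) prime» (`ClassX11b.dvd_and_not_ram_of_not_surj`), so §2 applies at `p = 3`.
So re-pointing conjunct 4 to `CornerAtThreeFHTwinLowerSupply` is a pure WEAKENING of the registered stub (the facts
bundle `stub_cornerFacts3` already carries `hGZK`, `hmod`, `hnf`, `hFH`). Bookkeeping; CONDITIONAL.
[cite: FriedbergHoffstein1995, Thm. B] [cite: Miller2011LMS, Def. 1.1] -/
theorem cornerAtThreeFHTwinLowerSupply_of_friedbergHoffstein_of_x11aLowerHalfAtThree
    (hGZK : rank_eq_analyticRank_of_analyticRank_le_one) (hmod : hasEntireLFunction_rat)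
    (hnf : exists_isNewformOf)
    (hFH : friedbergHoffstein_exists_twist_ne_zero_inertAt)
    (hX11a : ∀ (V : WeierstrassCurve ℚ) [V.IsElliptic] [V.IsGloballyMinimal],
      ClassX11a V 3 → Typed.MissingLowerBoundAt V 3) :
    CornerAtThreeFHTwinLowerSupply := by
  haveI : Fact (Nat.Prime 3) := ⟨Nat.prime_three⟩
  intro W _ _ hX hns
  exact fhTwinLowerSupplyAt_of_friedbergHoffstein_of_x11aLowerHalf hGZK hmod hnf hFH W 3 hX
    (ClassX11b.dvd_and_not_ram_of_not_surj W 3 hX hns).2 hX11a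

end Summit.BirchSwinnertonDyer.BirchSwinnertonDyer.Theorems

end
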